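import Summits.BirchSwinnertonDyer.BirchSwinnertonDyer.Theorems.ByReductionTypeAtTwoMultLowerHalfSelmerRankSplit
import Summits.BirchSwinnertonDyer.Rank1Residual.X5.TwoAdicTargetsSplitKappaCert
import HarnessLib

/-!
# Route `ByReductionTypeAtTwo`, child `MultLowerHalfAtTwo` (item stmt-BirchSwinnertonDyer-19923): the SPLIT
# Kato-INT pinch doors of the SelmerRank road WITHOUT the named fact `greenberg_stevens W 2` — the `κ₁`-valuation
# CERTIFICATE `X5.O1.AnalyticKappaOneValuationAtTwo W` (mult GEN 8, p451828) in place of `hGS`, and the binder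
# `hlow` discharged by one finite-layer count (mult-3 GEN 6, p445915/p446547)

HONEST FRAMING (cell `bsd-2adic`, run/shared/lean/pub/bsd-2adic/, seat `bsd-2adic-mult-3` GEN 7, HUMAN RULINGS
D-0036 / D-0054 / D-0074 row (A)): research route; THEOREMS ONLY — no definition, no new named fact, nothing
asserted, nothing booked; BSD is not proved by any of this. PARTITION (D-0054): X5@2 mult, SPLIT, `E[2]`
irreducible (K4ᵐ, RESIDUAL-MAP B1·O1; the split ∧ `ρ_{E,2^∞}` surjective ∧ `Δ < 0` rows of the SelmerRank road:
tier 1 (97, `λ_an = 3`, `j = 0`), tier 2 (118 `λ_an = 4` at `j = 1`; 53 `λ_an = 5` at `j ≤ 2`), tier 3 (50 + 16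
at `j ≤ 2`) — HOME/mult3/sel2layer-k4/; and the 36 split `Δ > 0` tier-1 classes of the slack-one face) × p = 2 —
types-the-object-of (item 19923 per class); closes none by itself.

WHAT THIS FILE DOES. The companion `…MultLowerHalfSelmerRankSplit.lean` (GEN 6) glued the SPLIT Kato-INT pinch
doors of `X5/TwoAdicTargetsMultKatoIntSplit{,Pos}` to the PRINT discharge of `hlow` — but kept the named fact
`greenberg_stevens W 2` (`hGS`: printed for `p ≥ 5`, Greenberg–Stevens 1993, and odd `p`, Kobayashi 2006; at `2`
a cell MEMO, PROOF-GS2 RC-4; T5 literature seats mult-gs-a, -b, -c 2026-08-26: no flag-free print of the STRONG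
form at `p = 2`). Seat `bsd-2adic-mult` GEN 8 observed that those doors consume `hGS` only through its valuation
shadow `c₁ ≠ 0 ∧ ord₂ c₁ = ord₂ 𝓛₂(E) + ord₂ [0]⁺_f − 2`, TYPED it as the per-class finite check
`X5.O1.AnalyticKappaOneValuationAtTwo W` (`hκ`; implied by `hGS` in analytic rank `0`,
`analyticKappaOneValuationAtTwo_of_greenbergStevens`; certified two legs × two engines on 239 split classes,
HOME/mult/CERT-KAPPA1.md) and re-typed the X5 doors on it (`…_of_kappaCert`, p451828). Here the two
improvements are COMPOSED, one application each:
* §1 `bsdp_two_split_of_katoInt_of_layerSelmer_of_kappaCert` / `…_of_selmerTwoTorsion_of_kappaCert`: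
  `BSDp W 2` at a split, surjective, `Δ < 0` curve of analytic rank `0` from PRINT {A236 `h41`, `hmod`, `hGZK`,
  Prop. 4.14@2 `h414`} + MEMO {T-KATO2-SPMULT `hKint`} + CERTIFICATES {`hκ`, `hlan`, `hμan`, `hsel`} — no `hGS`,
  no `hlow`, no period datum;
* §2 `bsdp_two_split_of_katoUpToOnePinch_of_mu_of_layerSelmer_of_kappaCert`: the `Δ > 0` face (slack-one datum
  `hK1sp`, displayed `μ(X) = 0` hypothesis `hμX`, `hper₀`, `htors`) likewise without `hGS` and `hlow`;
* §3 `missingLowerBoundAt_two_split_of_katoInt_of_layerSelmer_of_kappaCert` /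
  `missingUpperBoundAt_two_split_of_katoInt_of_layerSelmer_of_kappaCert`: the instances of items 19923 / 19922
  (`Typed.MissingLowerBoundAt W 2` / `Typed.MissingUpperBoundAt W 2`) at such a curve.
Every theorem here is implied by its `hGS` original of the companion file (the certificate is weaker than the
named fact in analytic rank `0`), so nothing is lost; what is gained is that the split rows' only displayed
input beyond PRINT + CERTIFICATES is the MEMO `hKint`. NOT HERE: the rank-`0` `2`-converse twins (there
`greenberg_stevens W 2` is genuine content, `[T¹]L ≠ 0 ⇒ [0]⁺_f ≠ 0`; they keep `hGS` in the companion).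

WHAT IS DISPLAYED, NOT PROVED (numbers, not adjectives). PRINT: A236 (`h41`, Greenberg's split base-change
display, audit V3 PASS), Prop. 4.14 at `2` (`h414`, audit PASS), modularity (`hmod`), GZK (`hGZK`). MEMO:
T-KATO2-SPMULT (`hKint`, HOME/mult/PROOF-KATO2SPLIT.md Thm. B; referee RC-27/32/35/41) resp. the slack-one
datum `hK1sp` + `hμX` (§2) — UNCHANGED. CERTIFICATES per class: `κ₁` (`hκ`), `λ_an = n + 1` (`hlan`), `μ_an = 0`
(`hμan`), `2^n ≤ #Sel_{2^∞}(E/ℚ_j)[2]` (`hsel`; tiers 1–3 of HOME/mult3/sel2layer-k4/, 708 rows two-engine),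
`hper₀` (§2 only). ∀-LEVEL CONTENT for 19923: none (open mathematics — the Eisenstein direction of the `2`-adic
main conjecture at a multiplicative `2`; seat verdict GEN 0–7).

References: R. Greenberg, LNM 1716 (1999), §1 p. 60, §3 pp. 85–86 and p. 94, Prop. 4.14 (p. 124), §4
pp. 112–113; R. Greenberg, G. Stevens, Invent. Math. 111 (1993), (0.6); S. Kobayashi, Doc. Math. Extra Vol.
Coates (2006), Cor. 4.2; K. Kato, Astérisque 295 (2004), 17.11–17.13; B. Mazur, J. Tate, J. Teitelbaum,
Invent. Math. 84 (1986), §I.13–15, §II; R. L. Miller, LMS J. Comput. Math. 14 (2011), Def. 1.1;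
K. Barré-Sirieix, G. Diaz, F. Gramain, G. Philibert, Invent. Math. 124 (1996), Thm. 1.
-/

set_option autoImplicit false
-- the route's Theorems namespace repeats a component by design (summit = sub-problem, D-0017 nested layout)
set_option linter.dupNamespace false

noncomputable section

open scoped Classical MatrixGroups ModularForm

open CongruenceSubgroup WeierstrassCurve Literature.NumberTheory.EllipticCurves
  Literature.NumberTheory.EllipticCurves.ModularForms
  Literature.NumberTheory.EllipticCurves.Greenberg1999
  Literature.NumberTheory.EllipticCurves.Rank1Residual
  Literature.NumberTheory.EllipticCurves.Rank1Residual.Typed Summit.BirchSwinnertonDyer.Rank1Residual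
  Summit.BirchSwinnertonDyer.Rank1Residual.X5 Summit.BirchSwinnertonDyer.Rank1Residual.X5.O1

namespace Summit.BirchSwinnertonDyer.BirchSwinnertonDyer.Theorems.MultSelmerRank

variable (W : WeierstrassCurve ℚ) [W.IsElliptic] [W.IsGloballyMinimal]

/-! ## §1 Door 34-INT-pinch-split (`Δ < 0`, surjective) on the `κ₁`-certificate, `hlow` discharged -/

/-- **DOOR (34-INT-pinch-split) on the `κ₁`-CERTIFICATE with `hlow` DISCHARGED — `BSDp W 2`, both halves, at a
SPLIT `2` with `ρ_{E,2^∞}` surjective and `Δ < 0`.** Binders: PRINT {A236 `h41`, modularity `hmod`, GZK `hGZK`,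
Greenberg Prop. 4.14@2 `h414`}; MEMO {T-KATO2-SPMULT `hKint`} ONLY; CERTIFICATES {`κ₁`-valuation `hκ`,
`λ_an(E) = n + 1` (`hlan`, trivial zero included), `μ_an(E) = 0` (`hμan`), the layer count
`2^n ≤ #Sel_{2^∞}(E/ℚ_j)[2]` (`hsel`)}; the curve's decidable data {`Mult W 2`, split, `TwoAdicSurjective W`,
`Δ < 0`}; analytic rank `0`. One application of `X5.O1.bsdp_two_split_of_katoIntPinch_of_kappaCert` (p451828)
to the companion's `selmerLambdaLowerBoundAtTwo_of_layerSelmer_of_twoAdicSurjective` (p445915). No `hGS`.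
[cite: GreenbergLNM1716, §4 pp. 112–113 (split l_v), §3 p. 94 and Prop. 4.14 (p. 124)]
[cite: MazurTateTeitelbaum1986Invent, §I.13–15 and §II] [cite: Miller2011LMS, Def. 1.1 and §1] -/
theorem bsdp_two_split_of_katoInt_of_layerSelmer_of_kappaCert {j n : ℕ}
    (h41 : thm41Analogue_charValue_rankZero_split_baseChange_anyPrime)
    (hκ : AnalyticKappaOneValuationAtTwo W)
    (hmod : nonempty_modularParametrizationData)
    (hGZK : rank_eq_analyticRank_of_analyticRank_le_one)
    (h414 : prop414_noFiniteSubmodule_of_not_dvd_torsionOrder)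
    (hKint : KatoDivisibilityAtTwoSplitMultInt W)
    (hr : W.analyticRank = 0) (hmult : Mult W 2) (hsp : W.HasSplitMultiplicativeReductionAtPrime 2)
    (him : TwoAdicSurjective W) (hΔ : W.Δ < 0)
    (hlan : X2.AnalyticLambdaEq W 2 (n + 1)) (hμan : X2.AnalyticMuLE W 2 0)
    (hsel : ∀ κ : ZpExtension ℚ 2, κ.IsCyclotomic →
      2 ^ n ≤ Nat.card {z : W.selmerLayer κ j // 2 • z = 0}) : BSDp W 2 :=
  bsdp_two_split_of_katoIntPinch_of_kappaCert W h41 hκ hmod hGZK hKint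
    (selmerLambdaLowerBoundAtTwo_of_layerSelmer_of_twoAdicSurjective W h414 him hsel)
    hr hmult hsp him hΔ hlan hμan

/-- **DOOR (34-INT-pinch-split) on the `κ₁`-CERTIFICATE with `hlow` DISCHARGED from the layer-`0` count
`2^n ≤ #Sel_{2^∞}(E/ℚ)[2]`** (the TIER-1-SPLIT habitat: `n = 2 = dim_{𝔽₂} Sel₂(E/ℚ)`, `λ_an = 3`): `BSDp W 2`
with MEMO {`hKint`} only and no named fact beyond PRINT. [cite: GreenbergLNM1716, §4 pp. 112–113 and Prop. 4.14 (p. 124)]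
[cite: MazurTateTeitelbaum1986Invent, §I.13–15] [cite: Miller2011LMS, Def. 1.1 and §1] -/
theorem bsdp_two_split_of_katoInt_of_selmerTwoTorsion_of_kappaCert {n : ℕ}
    (h41 : thm41Analogue_charValue_rankZero_split_baseChange_anyPrime)
    (hκ : AnalyticKappaOneValuationAtTwo W)
    (hmod : nonempty_modularParametrizationData)
    (hGZK : rank_eq_analyticRank_of_analyticRank_le_one)
    (h414 : prop414_noFiniteSubmodule_of_not_dvd_torsionOrder)
    (hKint : KatoDivisibilityAtTwoSplitMultInt W)
    (hr : W.analyticRank = 0) (hmult : Mult W 2) (hsp : W.HasSplitMultiplicativeReductionAtPrime 2)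
    (him : TwoAdicSurjective W) (hΔ : W.Δ < 0)
    (hlan : X2.AnalyticLambdaEq W 2 (n + 1)) (hμan : X2.AnalyticMuLE W 2 0)
    (hsel : 2 ^ n ≤ Nat.card {z : W.selmerGroupPInfty 2 // 2 • z = 0}) : BSDp W 2 :=
  bsdp_two_split_of_katoIntPinch_of_kappaCert W h41 hκ hmod hGZK hKint
    (selmerLambdaLowerBoundAtTwo_of_selmerTwoTorsion W h414
      (not_two_dvd_torsionOrder_of_twoAdicSurjective W him) hsel)
    hr hmult hsp him hΔ hlan hμan

/-! ## §2 Door 34-INT-pinch-split⁺ (`Δ > 0` face, slack one, `μ(X) = 0` displayed) on the certificate -/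

/-- **DOOR (34-INT-pinch-split⁺) on the `κ₁`-CERTIFICATE with `hlow` DISCHARGED — `BSDp W 2` at a SPLIT `2` from
the slack-ONE datum.** Binders: PRINT {A236 `h41`, `hmod`, `hGZK`, Prop. 4.14@2 `h414`}; MEMO {the slack-one
divisibility `hK1sp` (`ι(T·g) = 2ϖ·L`, `g ∈ char X`)}; the HYPOTHESIS `hμX : μ(X(E/ℚ_∞)) = 0` (displayed, not
discharged); CERTIFICATES {`hκ`, `hlan` (`n + 1`), `hμan`, `hper₀`, the layer count `hsel`}; the torsion side
condition `2 ∤ #E(ℚ)_tors` (`htors`; e.g. `not_two_dvd_torsionOrder_of_twoAdicSurjective`); {`Mult W 2`,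
split}; analytic rank `0`. One application of `X5.O1.bsdp_two_split_of_katoUpToOnePinch_of_mu_of_kappaCert`
(p451828) to `selmerLambdaLowerBoundAtTwo_of_layerSelmer` (p445915). No `hGS`.
[cite: GreenbergLNM1716, §4 pp. 112–113 (split l_v), Conj. 1.11 and Prop. 4.14 (p. 124)]
[cite: MazurTateTeitelbaum1986Invent, §I.10, §I.13–15 and §II] [cite: Miller2011LMS, Def. 1.1 and §1] -/
theorem bsdp_two_split_of_katoUpToOnePinch_of_mu_of_layerSelmer_of_kappaCert {j n : ℕ}
    (h41 : thm41Analogue_charValue_rankZero_split_baseChange_anyPrime)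
    (hκ : AnalyticKappaOneValuationAtTwo W)
    (hmod : nonempty_modularParametrizationData)
    (hGZK : rank_eq_analyticRank_of_analyticRank_le_one)
    (h414 : prop414_noFiniteSubmodule_of_not_dvd_torsionOrder)
    (hK1sp : ∀ (κ : ZpExtension ℚ 2) (γ : Field.absoluteGaloisGroup ℚ), κ.IsCyclotomic →
      κ.IsTopGenerator γ → IsCyclotomicVariable 2 γ →
      ∀ [NeZero (W.conductorNorm ℤ)] (f : CuspForm (Gamma0 (W.conductorNorm ℤ)) 2), IsNewformOf W f →
      ∀ ϖ : ℚ, (ϖ : ℝ) * W.realPeriodRat = plusPeriod f →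
      ∀ L : PowerSeries ℚ_[2], IsSplitMultPAdicLFunctionOf f 2 L → ∀ D : W.SelmerDualData κ γ,
        D.IsTorsion ∧ ∃ g ∈ D.charIdeal,
          iwasawaToPowerSeries 2 (PowerSeries.X * g) = PowerSeries.C ((2 * ϖ : ℚ) : ℚ_[2]) * L)
    (hμX : ∀ (κ : ZpExtension ℚ 2) (γ : Field.absoluteGaloisGroup ℚ), κ.IsCyclotomic →
      κ.IsTopGenerator γ → IsCyclotomicVariable 2 γ → ∀ D : W.SelmerDualData κ γ, D.IsTorsion → D.mu = 0)
    (hper₀ : ∀ [NeZero (W.conductorNorm ℤ)] (f : CuspForm (Gamma0 (W.conductorNorm ℤ)) 2),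
      IsNewformOf W f → ∀ ϖ : ℚ, (ϖ : ℝ) * W.realPeriodRat = plusPeriod f → 0 ≤ padicValRat 2 ϖ)
    (htors : ¬ 2 ∣ W.torsionOrder)
    (hr : W.analyticRank = 0) (hmult : Mult W 2) (hsp : W.HasSplitMultiplicativeReductionAtPrime 2)
    (hlan : X2.AnalyticLambdaEq W 2 (n + 1)) (hμan : X2.AnalyticMuLE W 2 0)
    (hsel : ∀ κ : ZpExtension ℚ 2, κ.IsCyclotomic →
      2 ^ n ≤ Nat.card {z : W.selmerLayer κ j // 2 • z = 0}) : BSDp W 2 :=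
  bsdp_two_split_of_katoUpToOnePinch_of_mu_of_kappaCert W h41 hκ hmod hGZK hK1sp hμX
    (selmerLambdaLowerBoundAtTwo_of_layerSelmer W h414 htors hsel) hper₀ hr hmult hsp hlan hμan

/-! ## §3 Items 19923 (`MultLowerHalfAtTwo`) and 19922 (`MultUpperHalfAtTwo`) AT a split tier-1/2/3 curve -/

/-- **The instance of `MultLowerHalfAtTwo` (item 19923) at a split, `2`-adically surjective, `Δ < 0` curve of
analytic rank `0`, on the `κ₁`-certificate: `Typed.MissingLowerBoundAt W 2`** from PRINT {`h41` (A236), `hmod`,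
`hGZK`, `h414`} + MEMO {`hKint`} + CERTIFICATES {`hκ`, `hlan`, `hμan`, `hsel`} — through `BSDp W 2` (§1) and the
finiteness of `Ш` at analytic rank `0` (GZK). No `hGS`, no `hlow`, no tower gap, no period datum.
[cite: Miller2011LMS, Def. 1.1 (arXiv:1010.2431 p. 3)] [cite: GreenbergLNM1716, Prop. 4.14 (p. 124)] -/
theorem missingLowerBoundAt_two_split_of_katoInt_of_layerSelmer_of_kappaCert {j n : ℕ}
    (h41 : thm41Analogue_charValue_rankZero_split_baseChange_anyPrime)
    (hκ : AnalyticKappaOneValuationAtTwo W)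
    (hmod : nonempty_modularParametrizationData)
    (hGZK : rank_eq_analyticRank_of_analyticRank_le_one)
    (h414 : prop414_noFiniteSubmodule_of_not_dvd_torsionOrder)
    (hKint : KatoDivisibilityAtTwoSplitMultInt W)
    (hr : W.analyticRank = 0) (hmult : Mult W 2) (hsp : W.HasSplitMultiplicativeReductionAtPrime 2)
    (him : TwoAdicSurjective W) (hΔ : W.Δ < 0)
    (hlan : X2.AnalyticLambdaEq W 2 (n + 1)) (hμan : X2.AnalyticMuLE W 2 0)
    (hsel : ∀ κ : ZpExtension ℚ 2, κ.IsCyclotomic →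
      2 ^ n ≤ Nat.card {z : W.selmerLayer κ j // 2 • z = 0}) : MissingLowerBoundAt W 2 := by
  haveI : Finite W.sha := (hGZK W (by rw [hr]; exact zero_le_one)).2
  exact (lower_and_upper_of_missingPPartAt W 2 (missingPPartAt_of_bsdp W 2
    (bsdp_two_split_of_katoInt_of_layerSelmer_of_kappaCert W h41 hκ hmod hGZK h414 hKint hr hmult hsp him hΔ
      hlan hμan hsel))).1

/-- **The instance of `MultUpperHalfAtTwo` (item 19922) at the same curve, on the `κ₁`-certificate:
`Typed.MissingUpperBoundAt W 2`** — through `BSDp W 2` (§1). (For the upper half ALONE no `λ`/`μ`/Selmer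
certificate is needed: `X5.O1.missingUpperBoundAt_two_split_of_katoInt_of_kappaCert`, p451828; this form is the
one a BSD₂ row displays.) [cite: Miller2011LMS, Def. 1.1 (arXiv:1010.2431 p. 3)] [cite: GreenbergLNM1716, Prop. 4.14 (p. 124)] -/
theorem missingUpperBoundAt_two_split_of_katoInt_of_layerSelmer_of_kappaCert {j n : ℕ}
    (h41 : thm41Analogue_charValue_rankZero_split_baseChange_anyPrime)
    (hκ : AnalyticKappaOneValuationAtTwo W)
    (hmod : nonempty_modularParametrizationData)
    (hGZK : rank_eq_analyticRank_of_analyticRank_le_one)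
    (h414 : prop414_noFiniteSubmodule_of_not_dvd_torsionOrder)
    (hKint : KatoDivisibilityAtTwoSplitMultInt W)
    (hr : W.analyticRank = 0) (hmult : Mult W 2) (hsp : W.HasSplitMultiplicativeReductionAtPrime 2)
    (him : TwoAdicSurjective W) (hΔ : W.Δ < 0)
    (hlan : X2.AnalyticLambdaEq W 2 (n + 1)) (hμan : X2.AnalyticMuLE W 2 0)
    (hsel : ∀ κ : ZpExtension ℚ 2, κ.IsCyclotomic →
      2 ^ n ≤ Nat.card {z : W.selmerLayer κ j // 2 • z = 0}) : MissingUpperBoundAt W 2 := by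
  haveI : Finite W.sha := (hGZK W (by rw [hr]; exact zero_le_one)).2
  exact (lower_and_upper_of_missingPPartAt W 2 (missingPPartAt_of_bsdp W 2
    (bsdp_two_split_of_katoInt_of_layerSelmer_of_kappaCert W h41 hκ hmod hGZK h414 hKint hr hmult hsp him hΔ
      hlan hμan hsel))).2

end Summit.BirchSwinnertonDyer.BirchSwinnertonDyer.Theorems.MultSelmerRank

end
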